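import Summits.Parity.GeneralizedHardyLittlewood.Theorems.GreenTaoLevelTwoMNTwoVerticalOfInverseLargeN
import Summits.Parity.GeneralizedHardyLittlewood.Theorems.GreenTaoLevelTwoMNTwoMajorArcOfPropTwentyTwo
import Summits.Parity.GeneralizedHardyLittlewood.Theorems.GreenTaoLevelTwoMNTwoRhoLowerBound

/-!
# Route `GreenTaoLevelTwo`, crux `MNTwo` (stmt-Parity-21276), line `birth`, stub `stub_mnVertical`:
# the large-`N` inverse statement `hInvL` from Proposition 22 at the budget scale (GT 2008b §§10–11)

Block H6 / R5 of the `stub_mnVertical` census (B. Green, T. Tao, *Quadratic uniformity of the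
Möbius function*, Ann. Inst. Fourier 58 (2008) = arXiv:math/0606087, §10: "we conclude from
(fphi-2) that `ρ₀ ≳ 1`" (eq. (r-big)) and §11: "We will choose `ρ₁ := log^{-C₂(A+1)}N`").
Since `…MNTwoVerticalOfInverseLargeN.stub_mnVertical_of_majorArcInverse_largeN` the remaining target
of the stub is the inverse statement `hInvL k` (all `k`).  The §11 side is in the tree with all
parameters chosen in terms of ONE polylogarithmic budget `P`
(`…MNTwoMajorArcOfPropTwentyTwo.majorArc_of_prop22`).  This def-free file fixes the budget
`P := log^{A₀} N` and reduces `hInvL k` to the §10 deliverable "PROPOSITION 22 AT THE BUDGET SCALE":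
for every `A > 0` and every requested floor `A₁` there are `A₀ ≥ A₁` and `N₀` such that, for
`N ≥ N₀` and Prop-19 data `(α, n₀, ρ, φ, ψ)` (hypotheses of `hInvL` verbatim, plus the free lower
bound `(6 log^A N)⁻¹ ≤ ρ` of (r-big)) with a large sum `‖Σ_{N<n≤2N} μψe(−φ)‖ ≥ N/log^A N`, the
conclusion of Prop. 22 holds at the single scale `ρ₁ = P^{-(k+2)(4+4^{k+2})}` with budget
`P = log^{A₀} N` (divisors `𝒟 ⊆ [1,D]`, `4·32·38ᵏD ≤ (ρ₁/16)^{k+1}N/2`, `ρ₁D²/P ≤ #𝒟²`, and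
`‖qφ''(n,n)‖ ≤ Pρ₁²` with `1 ≤ q ≤ P` at every multiple `n ∈ B(ρ₁)` of every `d ∈ 𝒟`) — exactly
the input `hP22` of `majorArc_of_prop22`, for the `ℝ/ℤ`-valued phase `↑∘φ`.

* `exists_largeN` — thresholds: `3 ≤ log N`, `3 log^A N ≤ N`, `P₀ ≤ log^{A₀} N` for `N ≥ N₁`;
* `rho_lower_bound` — (r-big): a large localized sum forces `(6 log^A N)⁻¹ ≤ ρ`;
* `majorArcInverse_largeN_of_prop22` — `hInvL k` from Prop. 22 at the budget scale;
* `stub_mnVertical_of_prop22` — the registered signature of `stub_mnVertical` (verbatim) from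
  Prop. 22 at the budget scale for all `k`.

References: [GreenTao2008QuadraticMobius] arXiv:math/0606087 §10 (eq. (r-big), Prop. 22), §11.
-/

noncomputable section

open Finset Real ArithmeticFunction Filter Asymptotics
open scoped ArithmeticFunction.Moebius FourierTransform
open Literature.NumberTheory.Sieve
open Literature.NumberTheory.Sieve.GreenTaoLevelTwo (HX IsCompatMetric IsBoxComparable heisenbergWith
  InHeisClass)

namespace Summit.Parity.GeneralizedHardyLittlewood.GreenTaoLevelTwoMNTwoInverseOfPropTwentyTwo

open Summit.Parity.GeneralizedHardyLittlewood.GreenTaoLevelTwoMNTwoMajorArcOfPropTwentyTwo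
  (majorArc_of_prop22)
open Summit.Parity.GeneralizedHardyLittlewood.GreenTaoLevelTwoMNTwoRhoLowerBound
  (norm_localized_sum_le)
open Summit.Parity.GeneralizedHardyLittlewood.GreenTaoLevelTwoMNTwoPropNineteenGlue
  (cube_vanish_of_integral)
open Summit.Parity.GeneralizedHardyLittlewood.GreenTaoLevelTwoMNTwoVerticalOfInverseLargeN
  (stub_mnVertical_of_majorArcInverse_largeN)

variable {k : ℕ}

/-- **Thresholds in `N`.**  For `A, P₀ ∈ ℝ` and `A₀ ≥ 1` there is `N₁` with `3 ≤ log N`,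
`3 log^A N ≤ N` and `P₀ ≤ log^{A₀} N` for all `N ≥ N₁` (`log^A x = o(x)`). [folklore] -/
theorem exists_largeN (A A₀ P₀ : ℝ) (hA₀ : 1 ≤ A₀) :
    ∃ N₁ : ℕ, ∀ N : ℕ, N₁ ≤ N →
      3 ≤ Real.log N ∧ 3 * Real.log N ^ A ≤ (N : ℝ) ∧ P₀ ≤ Real.log N ^ A₀ := by
  have hlo := (isLittleO_log_rpow_rpow_atTop A one_pos).bound (by norm_num : (0 : ℝ) < 1 / 3)
  obtain ⟨T, hT⟩ := eventually_atTop.mp hlo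
  refine ⟨⌈max T (Real.exp (max 3 P₀))⌉₊, fun N hN => ?_⟩
  have hN' : max T (Real.exp (max 3 P₀)) ≤ N := (Nat.le_ceil _).trans (by exact_mod_cast hN)
  have hTN : T ≤ N := (le_max_left _ _).trans hN'
  have hexpN : Real.exp (max 3 P₀) ≤ N := (le_max_right _ _).trans hN'
  have hNpos : (0 : ℝ) < N := lt_of_lt_of_le (Real.exp_pos _) hexpN
  have hlogN : max 3 P₀ ≤ Real.log N := by
    rw [Real.le_log_iff_exp_le hNpos]; exact hexpN
  have h3 : 3 ≤ Real.log N := (le_max_left _ _).trans hlogN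
  refine ⟨h3, ?_, ?_⟩
  · have h1 := hT N hTN
    rw [Real.rpow_one, Real.norm_eq_abs, Real.norm_eq_abs, abs_of_pos hNpos,
      abs_of_nonneg (Real.rpow_nonneg (by linarith) A)] at h1
    linarith
  · calc P₀ ≤ Real.log N := (le_max_right _ _).trans hlogN
      _ = Real.log N ^ (1 : ℝ) := (Real.rpow_one _).symm
      _ ≤ Real.log N ^ A₀ := Real.rpow_le_rpow_of_exponent_le (by linarith) hA₀

/-- **(r-big): a large localized sum forces `ρ ≳ log^{-A} N`.**  If the nonnegative weight `ψ` is
supported in the Bohr ball `B(n₀,ρ)` (`2ρ < 1`), `ν`-Lipschitz, and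
`N/log^A N ≤ ‖Σ_{N<n≤2N} μ(n)ψ(n)e(−φ(n))‖` with `3 log^A N ≤ N`, then `(6 log^A N)⁻¹ ≤ ρ`.
[cite: GreenTao2008QuadraticMobius, §10, eq. (r-big)] -/
theorem rho_lower_bound (α : Fin k → ℝ) {N : ℕ} (hN : 1 ≤ N) (n₀ : ℤ) {ρ : ℝ}
    (hρ0 : 0 ≤ ρ) (hρ : 2 * ρ < 1) (ψ : ℤ → ℝ) (hψ0 : ∀ n, 0 ≤ ψ n)
    (hsupp : ∀ n, ψ n ≠ 0 →
      (∀ i, ‖((((n - n₀ : ℤ) : ℝ) * α i : ℝ) : AddCircle (1 : ℝ))‖ +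
          |((n - n₀ : ℤ) : ℝ)| / N < ρ) ∧ |((n - n₀ : ℤ) : ℝ)| / N < ρ)
    (hlip : ∀ (n n' : ℤ) (t : ℝ), 0 ≤ t →
      (∀ i, ‖((((n - n' : ℤ) : ℝ) * α i : ℝ) : AddCircle (1 : ℝ))‖ ≤ t) →
        |ψ n - ψ n'| ≤ t + |((n - n' : ℤ) : ℝ)| / N)
    (φ : ℤ → ℝ) {A : ℝ} (hlogpos : 0 < Real.log N) (h3 : 3 * Real.log N ^ A ≤ (N : ℝ))
    (hlarge : (N : ℝ) / Real.log N ^ A ≤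
      ‖∑ n ∈ Ioc N (2 * N), ((μ n : ℝ) : ℂ) * ((ψ n : ℝ) : ℂ) * (𝐞 (-(φ n)) : ℂ)‖) :
    (6 * Real.log N ^ A)⁻¹ ≤ ρ := by
  have hL : 0 < Real.log N ^ A := Real.rpow_pos_of_pos hlogpos A
  have hNr : (0 : ℝ) < N := by exact_mod_cast hN
  have h1 : (N : ℝ) / Real.log N ^ A ≤ 3 / 2 * (2 * ρ * N + 1) :=
    hlarge.trans (norm_localized_sum_le α hN n₀ hρ0 hρ ψ hψ0 hsupp hlip φ)
  rw [div_le_iff₀ hL] at h1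
  rw [inv_le_iff_one_le_mul₀ (by positivity)]
  -- `N ≤ 3ρN·L + (3/2)L` and `3L ≤ N` give `N/2 ≤ 3ρN·L`
  have h2 : (N : ℝ) / 2 ≤ 3 * ρ * N * Real.log N ^ A := by nlinarith
  have h3' : (1 : ℝ) / 2 ≤ 3 * ρ * Real.log N ^ A := by
    have := div_le_div_of_nonneg_right h2 hNr.le
    rw [show (N : ℝ) / 2 / N = 1 / 2 by field_simp] at this
    refine this.trans (le_of_eq ?_)
    field_simp
  linarith

/-- **The large-`N` major-arc inverse statement `hInvL k` from Proposition 22 at the budget scale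
(GT 2008b §§10–11).**  The hypothesis `h22` is "Prop. 22 at the budget scale" described in the
module docstring (the §10 deliverable: Lemmas 23 and 24 through `…MNTwoScaleOfProgression`); the
conclusion is `hInvL k` verbatim, i.e. the hypothesis of
`…MNTwoVerticalOfInverseLargeN.propNineteen_of_majorArcInverse_largeN k`.  Proof: with `A₁ = A + 2`
take `A₀, N₀` from `h22` and `B, P₀` from `majorArc_of_prop22 k`; for `N ≥ max N₀ N₁`
(`exists_largeN`) the budget `P = log^{A₀}N` has `P ≥ P₀`, `1 + log N ≤ P` and, by (r-big),
`P⁻¹ ≤ (6 log^A N)⁻¹ ≤ ρ`; §11 then returns `q, K ≤ P^B = log^{A₀B}N` and `P^{-B} ≤ ρ₃ ≤ ρ`.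
[cite: GreenTao2008QuadraticMobius, §10 (Prop. 22, (r-big)), §11] -/
theorem majorArcInverse_largeN_of_prop22 (k : ℕ)
    (h22 : ∀ A : ℝ, 0 < A → ∀ A₁ : ℝ, ∃ A₀ : ℝ, A₁ ≤ A₀ ∧ ∃ N₀ : ℕ, ∀ N : ℕ, N₀ ≤ N → 2 ≤ N →
      ∀ (α : Fin k → ℝ) (n₀ : ℤ) (ρ : ℝ),
      0 < ρ → 100000 * ρ < 1 → (6 * Real.log N ^ A)⁻¹ ≤ ρ →
      (∀ n : ℤ, ((∀ i, ‖((((n - n₀ : ℤ) : ℝ) * α i : ℝ) : AddCircle (1 : ℝ))‖ +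
          |((n - n₀ : ℤ) : ℝ)| / N < 100 * ρ) ∧ |((n - n₀ : ℤ) : ℝ)| / N < 100 * ρ) →
        (N : ℤ) < n ∧ n ≤ 2 * N) →
      ∀ φ : ℤ → ℝ,
        (∀ n h₁ h₂ h₃ : ℤ,
          (∀ e₁ e₂ e₃ : ℕ, e₁ ≤ 1 → e₂ ≤ 1 → e₃ ≤ 1 →
            (∀ i, ‖((((n + e₁ * h₁ + e₂ * h₂ + e₃ * h₃ - n₀ : ℤ) : ℝ) * α i : ℝ) :
                AddCircle (1 : ℝ))‖ +
              |((n + e₁ * h₁ + e₂ * h₂ + e₃ * h₃ - n₀ : ℤ) : ℝ)| / N < 100 * ρ) ∧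
            |((n + e₁ * h₁ + e₂ * h₂ + e₃ * h₃ - n₀ : ℤ) : ℝ)| / N < 100 * ρ) →
          ∃ z : ℤ, φ (n + h₁ + h₂ + h₃) - φ (n + h₁ + h₂) - φ (n + h₁ + h₃) - φ (n + h₂ + h₃)
            + φ (n + h₁) + φ (n + h₂) + φ (n + h₃) - φ n = z) →
        ∀ ψ : ℤ → ℝ, (∀ n, 0 ≤ ψ n) →
          (∀ n, ψ n ≠ 0 →
            (∀ i, ‖((((n - n₀ : ℤ) : ℝ) * α i : ℝ) : AddCircle (1 : ℝ))‖ +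
                |((n - n₀ : ℤ) : ℝ)| / N < ρ) ∧ |((n - n₀ : ℤ) : ℝ)| / N < ρ) →
          (∀ (n n' : ℤ) (t : ℝ), 0 ≤ t →
            (∀ i, ‖((((n - n' : ℤ) : ℝ) * α i : ℝ) : AddCircle (1 : ℝ))‖ ≤ t) →
              |ψ n - ψ n'| ≤ t + |((n - n' : ℤ) : ℝ)| / N) →
          (N : ℝ) / Real.log N ^ A ≤
            ‖∑ n ∈ Ioc N (2 * N), ((μ n : ℝ) : ℂ) * ((ψ n : ℝ) : ℂ) * (𝐞 (-(φ n)) : ℂ)‖ →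
          ∀ ρ₁ : ℝ, ρ₁ = ((Real.log N ^ A₀) ^ ((k + 2) * (4 + 4 ^ (k + 2))))⁻¹ →
            ∃ (D : ℕ) (𝒟 : Finset ℕ), 1 ≤ D ∧ 𝒟 ⊆ Icc 1 D ∧
              4 * (32 * 38 ^ k) * (D : ℝ) ≤ (ρ₁ / 16) ^ (k + 1) * N / 2 ∧
              ρ₁ * (D : ℝ) ^ 2 / Real.log N ^ A₀ ≤ (#𝒟 : ℝ) ^ 2 ∧
              ∀ d ∈ 𝒟, ∀ n ∈ (Finset.Ioo (-(N : ℤ)) N).filter fun n : ℤ =>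
                  (∀ i, ‖(((n : ℝ) * α i : ℝ) : AddCircle (1 : ℝ))‖ + |(n : ℝ)| / N < ρ₁) ∧
                    |(n : ℝ)| / N < ρ₁,
                (d : ℤ) ∣ n → ∃ q : ℕ, 1 ≤ q ∧ (q : ℝ) ≤ Real.log N ^ A₀ ∧
                  ‖((q : ℤ)) • ((((φ (n₀ + n + n) : ℝ) : UnitAddCircle)) -
                    ((φ (n₀ + n) : ℝ) : UnitAddCircle) - ((φ (n₀ + n) : ℝ) : UnitAddCircle) +
                    ((φ n₀ : ℝ) : UnitAddCircle))‖ ≤ Real.log N ^ A₀ * ρ₁ ^ 2) :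
    ∀ A : ℝ, 0 < A → ∃ B : ℝ, 0 ≤ B ∧ ∃ N₀ : ℕ, ∀ N : ℕ, N₀ ≤ N → 2 ≤ N →
      ∀ (α : Fin k → ℝ) (n₀ : ℤ) (ρ : ℝ),
      0 < ρ → 100000 * ρ < 1 →
      (∀ n : ℤ, ((∀ i, ‖((((n - n₀ : ℤ) : ℝ) * α i : ℝ) : AddCircle (1 : ℝ))‖ +
          |((n - n₀ : ℤ) : ℝ)| / N < 100 * ρ) ∧ |((n - n₀ : ℤ) : ℝ)| / N < 100 * ρ) →
        (N : ℤ) < n ∧ n ≤ 2 * N) →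
      ∀ φ : ℤ → ℝ,
        (∀ n h₁ h₂ h₃ : ℤ,
          (∀ e₁ e₂ e₃ : ℕ, e₁ ≤ 1 → e₂ ≤ 1 → e₃ ≤ 1 →
            (∀ i, ‖((((n + e₁ * h₁ + e₂ * h₂ + e₃ * h₃ - n₀ : ℤ) : ℝ) * α i : ℝ) :
                AddCircle (1 : ℝ))‖ +
              |((n + e₁ * h₁ + e₂ * h₂ + e₃ * h₃ - n₀ : ℤ) : ℝ)| / N < 100 * ρ) ∧
            |((n + e₁ * h₁ + e₂ * h₂ + e₃ * h₃ - n₀ : ℤ) : ℝ)| / N < 100 * ρ) →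
          ∃ z : ℤ, φ (n + h₁ + h₂ + h₃) - φ (n + h₁ + h₂) - φ (n + h₁ + h₃) - φ (n + h₂ + h₃)
            + φ (n + h₁) + φ (n + h₂) + φ (n + h₃) - φ n = z) →
        ∀ ψ : ℤ → ℝ, (∀ n, 0 ≤ ψ n) →
          (∀ n, ψ n ≠ 0 →
            (∀ i, ‖((((n - n₀ : ℤ) : ℝ) * α i : ℝ) : AddCircle (1 : ℝ))‖ +
                |((n - n₀ : ℤ) : ℝ)| / N < ρ) ∧ |((n - n₀ : ℤ) : ℝ)| / N < ρ) →
          (∀ (n n' : ℤ) (t : ℝ), 0 ≤ t →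
            (∀ i, ‖((((n - n' : ℤ) : ℝ) * α i : ℝ) : AddCircle (1 : ℝ))‖ ≤ t) →
              |ψ n - ψ n'| ≤ t + |((n - n' : ℤ) : ℝ)| / N) →
          (N : ℝ) / Real.log N ^ A ≤
            ‖∑ n ∈ Ioc N (2 * N), ((μ n : ℝ) : ℂ) * ((ψ n : ℝ) : ℂ) * (𝐞 (-(φ n)) : ℂ)‖ →
          ∃ (q : ℕ) (K ρ₃ : ℝ), 1 ≤ q ∧ (q : ℝ) ≤ Real.log N ^ B ∧ 0 ≤ K ∧ K ≤ Real.log N ^ B ∧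
            (Real.log N ^ B)⁻¹ ≤ ρ₃ ∧ ρ₃ ≤ ρ ∧
            ∀ a b : ℤ,
              (⨆ i : Fin k, ‖(((a : ℝ) * α i : ℝ) : AddCircle (1 : ℝ))‖) + |(a : ℝ)| / N < ρ₃ →
              (⨆ i : Fin k, ‖(((b : ℝ) * α i : ℝ) : AddCircle (1 : ℝ))‖) + |(b : ℝ)| / N < ρ₃ →
              ‖q • ((((φ (n₀ + a + b) : ℝ) : UnitAddCircle)) - ((φ (n₀ + a) : ℝ) : UnitAddCircle)
                - ((φ (n₀ + b) : ℝ) : UnitAddCircle) + ((φ n₀ : ℝ) : UnitAddCircle))‖ ≤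
                K * ((⨆ i : Fin k, ‖(((a : ℝ) * α i : ℝ) : AddCircle (1 : ℝ))‖) + |(a : ℝ)| / N) *
                  ((⨆ i : Fin k, ‖(((b : ℝ) * α i : ℝ) : AddCircle (1 : ℝ))‖) + |(b : ℝ)| / N) := by
  intro A hA
  obtain ⟨A₀, hA₀, N₀, h22A⟩ := h22 A hA (A + 2)
  obtain ⟨B, P₀, hMA⟩ := majorArc_of_prop22 k
  have hA₀1 : 1 ≤ A₀ := by linarith
  obtain ⟨N₁, hN₁⟩ := exists_largeN A A₀ P₀ hA₀1
  refine ⟨A₀ * B, by positivity, max N₀ N₁, ?_⟩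
  intro N hN h2N α n₀ ρ hρ hρ1 hball φ hφ ψ hψ0 hsupp hlip hlarge
  have hN₀N : N₀ ≤ N := (le_max_left _ _).trans hN
  have hN₁N : N₁ ≤ N := (le_max_right _ _).trans hN
  obtain ⟨hlog3, h3LA, hP₀⟩ := hN₁ N hN₁N
  have hN1 : 1 ≤ N := by omega
  have hlogpos : 0 < Real.log N := by linarith
  have hLA : 0 < Real.log N ^ A := Real.rpow_pos_of_pos hlogpos A
  have hPpos : 0 < Real.log N ^ A₀ := Real.rpow_pos_of_pos hlogpos A₀
  -- (r-big)
  have hρA : (6 * Real.log N ^ A)⁻¹ ≤ ρ :=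
    rho_lower_bound α hN1 n₀ hρ.le (by linarith) ψ hψ0 hsupp hlip φ hlogpos h3LA hlarge
  -- the budget `P = log^{A₀} N`: `6 log^A N ≤ P`, `P⁻¹ ≤ ρ`, `1 + log N ≤ P`
  have hsq : Real.log N ^ (2 : ℝ) = Real.log N * Real.log N := by
    rw [Real.rpow_two, pow_two]
  have hP6 : 6 * Real.log N ^ A ≤ Real.log N ^ A₀ := by
    have h1 : Real.log N ^ (A + 2) ≤ Real.log N ^ A₀ :=
      Real.rpow_le_rpow_of_exponent_le (by linarith) hA₀
    have h2 : Real.log N ^ (A + 2) = Real.log N ^ A * Real.log N ^ (2 : ℝ) :=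
      Real.rpow_add hlogpos A 2
    have h3 : (9 : ℝ) ≤ Real.log N ^ (2 : ℝ) := by rw [hsq]; nlinarith
    nlinarith [hLA]
  have hPρ : (Real.log N ^ A₀)⁻¹ ≤ ρ :=
    (inv_anti₀ (by positivity) hP6).trans hρA
  have hlogP : 1 + Real.log N ≤ Real.log N ^ A₀ := by
    have h1 : Real.log N ^ (2 : ℝ) ≤ Real.log N ^ A₀ :=
      Real.rpow_le_rpow_of_exponent_le (by linarith) (by linarith)
    rw [hsq] at h1
    nlinarith
  -- the phase in `ℝ/ℤ` and Prop. 22 at the budget scale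
  have hφ' := cube_vanish_of_integral α N n₀ (100 * ρ) φ hφ
  have h22N := h22A N hN₀N h2N α n₀ ρ hρ hρ1 hρA hball φ hφ ψ hψ0 hsupp hlip hlarge
  -- §11
  obtain ⟨q, K, ρ₃, hq1, hqP, hK0, hKP, hρ₃P, hρ₃ρ, hbil⟩ :=
    hMA (Real.log N ^ A₀) hP₀ N hN1 hlogP α n₀ ρ hPρ hρ1
      (fun n => ((φ n : ℝ) : UnitAddCircle)) hφ' h22N
  have hPB : (Real.log N ^ A₀) ^ B = Real.log N ^ (A₀ * B) :=
    (Real.rpow_mul_natCast hlogpos.le A₀ B).symm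
  refine ⟨q, K, ρ₃, hq1, ?_, hK0, ?_, ?_, hρ₃ρ, fun a b ha hb => hbil a b ha hb⟩
  · rw [← hPB]; exact hqP
  · rw [← hPB]; exact hKP
  · rw [← hPB]; exact hρ₃P

/-- **`stub_mnVertical` from Proposition 22 at the budget scale (all torus dimensions).**  The
conclusion is the registered signature of `stub_mnVertical` verbatim (`B = 1`); composition of
`majorArcInverse_largeN_of_prop22` with
`…MNTwoVerticalOfInverseLargeN.stub_mnVertical_of_majorArcInverse_largeN`.
[cite: GreenTao2008QuadraticMobius, §2, §§8–12, App. A (the proof of the Main Theorem)] -/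
theorem stub_mnVertical_of_prop22
    (h22 : ∀ k : ℕ, ∀ A : ℝ, 0 < A → ∀ A₁ : ℝ, ∃ A₀ : ℝ, A₁ ≤ A₀ ∧ ∃ N₀ : ℕ, ∀ N : ℕ, N₀ ≤ N →
      2 ≤ N →
      ∀ (α : Fin k → ℝ) (n₀ : ℤ) (ρ : ℝ),
      0 < ρ → 100000 * ρ < 1 → (6 * Real.log N ^ A)⁻¹ ≤ ρ →
      (∀ n : ℤ, ((∀ i, ‖((((n - n₀ : ℤ) : ℝ) * α i : ℝ) : AddCircle (1 : ℝ))‖ +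
          |((n - n₀ : ℤ) : ℝ)| / N < 100 * ρ) ∧ |((n - n₀ : ℤ) : ℝ)| / N < 100 * ρ) →
        (N : ℤ) < n ∧ n ≤ 2 * N) →
      ∀ φ : ℤ → ℝ,
        (∀ n h₁ h₂ h₃ : ℤ,
          (∀ e₁ e₂ e₃ : ℕ, e₁ ≤ 1 → e₂ ≤ 1 → e₃ ≤ 1 →
            (∀ i, ‖((((n + e₁ * h₁ + e₂ * h₂ + e₃ * h₃ - n₀ : ℤ) : ℝ) * α i : ℝ) :
                AddCircle (1 : ℝ))‖ +
              |((n + e₁ * h₁ + e₂ * h₂ + e₃ * h₃ - n₀ : ℤ) : ℝ)| / N < 100 * ρ) ∧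
            |((n + e₁ * h₁ + e₂ * h₂ + e₃ * h₃ - n₀ : ℤ) : ℝ)| / N < 100 * ρ) →
          ∃ z : ℤ, φ (n + h₁ + h₂ + h₃) - φ (n + h₁ + h₂) - φ (n + h₁ + h₃) - φ (n + h₂ + h₃)
            + φ (n + h₁) + φ (n + h₂) + φ (n + h₃) - φ n = z) →
        ∀ ψ : ℤ → ℝ, (∀ n, 0 ≤ ψ n) →
          (∀ n, ψ n ≠ 0 →
            (∀ i, ‖((((n - n₀ : ℤ) : ℝ) * α i : ℝ) : AddCircle (1 : ℝ))‖ +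
                |((n - n₀ : ℤ) : ℝ)| / N < ρ) ∧ |((n - n₀ : ℤ) : ℝ)| / N < ρ) →
          (∀ (n n' : ℤ) (t : ℝ), 0 ≤ t →
            (∀ i, ‖((((n - n' : ℤ) : ℝ) * α i : ℝ) : AddCircle (1 : ℝ))‖ ≤ t) →
              |ψ n - ψ n'| ≤ t + |((n - n' : ℤ) : ℝ)| / N) →
          (N : ℝ) / Real.log N ^ A ≤
            ‖∑ n ∈ Ioc N (2 * N), ((μ n : ℝ) : ℂ) * ((ψ n : ℝ) : ℂ) * (𝐞 (-(φ n)) : ℂ)‖ →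
          ∀ ρ₁ : ℝ, ρ₁ = ((Real.log N ^ A₀) ^ ((k + 2) * (4 + 4 ^ (k + 2))))⁻¹ →
            ∃ (D : ℕ) (𝒟 : Finset ℕ), 1 ≤ D ∧ 𝒟 ⊆ Icc 1 D ∧
              4 * (32 * 38 ^ k) * (D : ℝ) ≤ (ρ₁ / 16) ^ (k + 1) * N / 2 ∧
              ρ₁ * (D : ℝ) ^ 2 / Real.log N ^ A₀ ≤ (#𝒟 : ℝ) ^ 2 ∧
              ∀ d ∈ 𝒟, ∀ n ∈ (Finset.Ioo (-(N : ℤ)) N).filter fun n : ℤ =>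
                  (∀ i, ‖(((n : ℝ) * α i : ℝ) : AddCircle (1 : ℝ))‖ + |(n : ℝ)| / N < ρ₁) ∧
                    |(n : ℝ)| / N < ρ₁,
                (d : ℤ) ∣ n → ∃ q : ℕ, 1 ≤ q ∧ (q : ℝ) ≤ Real.log N ^ A₀ ∧
                  ‖((q : ℤ)) • ((((φ (n₀ + n + n) : ℝ) : UnitAddCircle)) -
                    ((φ (n₀ + n) : ℝ) : UnitAddCircle) - ((φ (n₀ + n) : ℝ) : UnitAddCircle) +
                    ((φ n₀ : ℝ) : UnitAddCircle))‖ ≤ Real.log N ^ A₀ * ρ₁ ^ 2) :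
    (∀ (d : HX → HX → ℝ) (h : IsCompatMetric d), IsBoxComparable d →
      ∀ X : Nilmanifold 2, InHeisClass (heisenbergWith d h) X → ∀ m : ℕ,
        ∀ A : ℝ, 0 < A → ∃ C B : ℝ, ∀ M : ℝ, 1 ≤ M → ∀ N : ℕ, 2 ≤ N →
          ∀ (g : ((X.pow m).prod (Nilmanifold.circle.ofLE one_le_two)).G) (x : ((X.pow m).prod (Nilmanifold.circle.ofLE one_le_two)).G ⧸ ((X.pow m).prod (Nilmanifold.circle.ofLE one_le_two)).Γ) (F₁ F₂ : ((X.pow m).prod (Nilmanifold.circle.ofLE one_le_two)).G ⧸ ((X.pow m).prod (Nilmanifold.circle.ofLE one_le_two)).Γ → ℝ),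
            ((X.pow m).prod (Nilmanifold.circle.ofLE one_le_two)).IsBoundedLipschitz M F₁ → ((X.pow m).prod (Nilmanifold.circle.ofLE one_le_two)).IsBoundedLipschitz M F₂ →
            (∃ θ : ((X.pow m).prod (Nilmanifold.circle.ofLE one_le_two)).G → ℝ, ∀ z : ((X.pow m).prod (Nilmanifold.circle.ofLE one_le_two)).G, z ∈ Subgroup.center ((X.pow m).prod (Nilmanifold.circle.ofLE one_le_two)).G →
              ∀ x : ((X.pow m).prod (Nilmanifold.circle.ofLE one_le_two)).G ⧸ ((X.pow m).prod (Nilmanifold.circle.ofLE one_le_two)).Γ,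
                ((F₁ (z • x) : ℂ) + (F₂ (z • x) : ℂ) * Complex.I) =
                  Complex.exp (2 * Real.pi * Complex.I * θ z) * ((F₁ x : ℂ) + (F₂ x : ℂ) * Complex.I)) →
              ‖∑ n ∈ Finset.Icc 1 N, ((ArithmeticFunction.moebius n : ℝ) : ℂ) *
                  ((F₁ (g ^ n • x) : ℂ) + (F₂ (g ^ n • x) : ℂ) * Complex.I)‖ ≤
                C * M ^ B * N / Real.log N ^ A) :=
  stub_mnVertical_of_majorArcInverse_largeN fun k => majorArcInverse_largeN_of_prop22 k (h22 k)

end Summit.Parity.GeneralizedHardyLittlewood.GreenTaoLevelTwoMNTwoInverseOfPropTwentyTwo
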